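import Summits.BirchSwinnertonDyer.BirchSwinnertonDyer.Theorems.RamifiedHeegnerPairLeafPartnerOrdersUForwardLocal
import Summits.BirchSwinnertonDyer.BirchSwinnertonDyer.Theorems.RamifiedHeegnerPairLeafPartnerOrdersUHermiteLocal
import Literature.NumberTheory.Automorphic.BrandtColumnSums
import Literature.NumberTheory.Automorphic.BrandtEigenvectorDegreeZero
import Literature.NumberTheory.Automorphic.BrandtModuleMultiplicativity
import Mathlib.NumberTheory.Padics.RingHoms
import HarnessLib

/-!
# Route `RamifiedHeegnerPair`, crux U₁ `LeafRankOneUpperAtThree` (stmt-BirchSwinnertonDyer-26022), line `partnerdescent` —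
# the Hecke–Atkin–Lehner twist (HT) from the tree, part 5: **the columns of `U_ℓ` sum to `ℓ`** (`ℓ ∣ N⁺`), i.e. `U_ℓ` preserves degree
# zero — the second print input `hudeg` of ‹…LeafPartnerOrdersHeckeTwist› `heckeTwist_of_involution` DISCHARGED

HONEST FRAMING. Theorems only; helper file (`--supports stmt-BirchSwinnertonDyer-26022`); local–global algebra over the tree's Brandt layer
(‹QuaternionSubidealCount› sub-ideals ↔ local principal ideals; parts 2–4 of this series); no named fact, no `sorry`; nothing booked;
BSD is proved for no curve. Lead prover bsd-line-rhp-p2 g65, 2026-08-31.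

WHAT. For a Brandt setup `S` of type `(N⁺, N⁻)` with its chosen orientation and a prime `ℓ ∣ N⁺` (`e = v_ℓ(N⁺) ≥ 1`):
* `card_subideals_eq_card_localPrincipal_of_iff` — the bijection «invertible sub-ideals of `ℓ`-power index ↔ principal right ideals of
  `O₍ℓ₎`» of ‹QuaternionSubidealCount› restricted to a pair of predicates matched along `M ↦ α⁻¹ M₍ℓ₎`;
* `card_forward_localPrincipal` — **exactly `ℓ` principal right ideals `z O₍ℓ₎` of index `ℓ²` are forward** (`‖(Φ z)₀₀‖ = 1`): they are
  the `H_t O₍ℓ₎`, `t < ℓ` (part 4, realised in `D` by density);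
* `ncard_forward_subideals_eq` — every invertible right ideal `I` has exactly `ℓ` forward invertible sub-ideals of index `ℓ²`;
* `sum_uMatrix_eq` — **`Σ_i (U_ℓ)_{ij} = ℓ`**; `sum_uMatrix_mulVec_eq_zero` — **`U_ℓ` preserves `Σ v = 0`** (the hypothesis `hudeg` of
  `heckeTwist_of_involution`, verbatim). Bertolini–Darmon: «`U_p(e) = {e' : s(e') = t(e), e' ≠ ē}`» has `p` elements; W. Zhang §3.9.
[cite: BertoliniDarmon2001, §4.1 pp. 142–144] [cite: WZhang2014, §3.9 p. 214] [cite: VignerasLNM800, Ch. II §2 Thm. 2.3 (3)]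
-/

set_option linter.dupNamespace false
set_option autoImplicit false

noncomputable section

namespace Summit.BirchSwinnertonDyer.BirchSwinnertonDyer.Theorems.LeafPartnerOrders

open scoped Pointwise Matrix
open Matrix Literature.NumberTheory.Automorphic Literature.NumberTheory.Automorphic.Brandt
  Literature.NumberTheory.Automorphic.AtkinLehner

universe u

/-! ### The local–global bijection with a matched pair of filters -/

section Filtered

variable {B : Type u} [Ring B] [Algebra ℚ B] [IsQuaternionAlgebra ℚ B] {p : ℕ} [hp : Fact p.Prime]

/-- **Sub-ideals of `p`-power index ↔ principal ideals of `O₍ₚ₎`, with matched filters.** As ‹QuaternionSubidealCount›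
`card_subideals_eq_card_localPrincipal` (the bijection `M ↦ α⁻¹ M₍ₚ₎` for `I₍ₚ₎ = α O₍ₚ₎`, inverse by gluing), restricted to predicates `P`
on sub-ideals and `Q` on local lattices with `P M ↔ Q (α⁻¹ M₍ₚ₎)`. [cite: Voight2021, §26.4] -/
theorem card_subideals_eq_card_localPrincipal_of_iff (hdiv : ∀ x : B, x ≠ 0 → IsUnit x)
    {O I : Submodule ℤ B} (hO : IsZOrder O) (hI : IsInvertibleRightIdeal O I) {α : Bˣ} (hα : localAt p I = α • localAt p O)
    (j : ℕ) {P Q : Submodule ℤ B → Prop}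
    (hPQ : ∀ M : Submodule ℤ B, IsInvertibleRightIdeal O M → M ≤ I → M.toAddSubgroup.relIndex I.toAddSubgroup = p ^ j →
      (P M ↔ Q (α⁻¹ • localAt p M))) :
    Nat.card {M : invertibleRightIdeals O // ((M : Submodule ℤ B) ≤ I ∧
        (M : Submodule ℤ B).toAddSubgroup.relIndex I.toAddSubgroup = p ^ j) ∧ P M} =
      Nat.card {N : Submodule ℤ B // ((∃ z : Bˣ, (z : B) ∈ localAt p O ∧ N = z • localAt p O) ∧
        N.toAddSubgroup.relIndex (localAt p O).toAddSubgroup = p ^ j) ∧ Q N} := by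
  classical
  -- the inverse map: glue `α N` into `I`
  have hglue : ∀ N : {N : Submodule ℤ B // ((∃ z : Bˣ, (z : B) ∈ localAt p O ∧ N = z • localAt p O) ∧
      N.toAddSubgroup.relIndex (localAt p O).toAddSubgroup = p ^ j) ∧ Q N},
      ∃ M : Submodule ℤ B, IsInvertibleRightIdeal O M ∧ M ≤ I ∧
        M.toAddSubgroup.relIndex I.toAddSubgroup = p ^ j ∧ localAt p M = α • (N : Submodule ℤ B) ∧
          ∀ q : ℕ, q.Prime → q ≠ p → localAt q M = localAt q I := fun N ↦ by
    obtain ⟨⟨⟨z, hz, hN⟩, hidx⟩, -⟩ := N.2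
    rw [hN] at hidx ⊢
    simpa only [mul_smul] using exists_subideal_of_localPrincipal hdiv hO hI hα hz hidx
  choose g hginv hgle hgidx hgp hgq using hglue
  have hgN : ∀ N, α⁻¹ • localAt p (g N) = (N : Submodule ℤ B) := fun N ↦ by rw [hgp, inv_smul_smul]
  refine Nat.card_congr
    { toFun := fun M ↦ ⟨α⁻¹ • localAt p (M.1 : Submodule ℤ B),
        localPrincipal_of_subideal hdiv hO hα M.1.2 M.2.1.1 M.2.1.2, (hPQ _ M.1.2 M.2.1.1 M.2.1.2).mp M.2.2⟩
      invFun := fun N ↦ ⟨⟨g N, hginv N⟩, ⟨hgle N, hgidx N⟩, (hPQ _ (hginv N) (hgle N) (hgidx N)).mpr (by rw [hgN]; exact N.2.2)⟩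
      left_inv := fun M ↦ ?_
      right_inv := fun N ↦ ?_ }
  · apply Subtype.ext; apply Subtype.ext
    change g _ = (M.1 : Submodule ℤ B)
    refine eq_iff_forall_prime_localAt_eq.mpr fun q hq ↦ ?_
    by_cases hqp : q = p
    · subst hqp
      rw [hgp, smul_inv_smul]
    · rw [hgq _ q hq hqp, localAt_eq_of_relIndex_eq_prime_pow M.2.1.1 M.2.1.2 hp.out hq hqp]
  · apply Subtype.ext
    exact hgN N

end Filtered

/-! ### The `ℓ` forward principal ideals of `O₍ℓ₎` -/

section Local

variable {Nplus Nminus : ℕ} {S : XiSetup Nplus Nminus}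
variable {ℓ : ℕ} [hℓ : Fact ℓ.Prime] {e : ℕ} (Φ : S.D →ₐ[ℚ] Matrix (Fin 2) (Fin 2) ℚ_[ℓ])
  (hΦ₁ : ∀ x : S.D, x ∈ localAt ℓ S.O₁ ↔ ∀ i j, ‖Φ x i j‖ ≤ 1)
  (hΦ : ∀ x : S.D, x ∈ localAt ℓ S.O ↔ IsLevelShape e (Φ x))

/-- The algebra of a setup is a division algebra. [folklore] -/
private theorem hdivD : ∀ x : S.D, x ≠ 0 → IsUnit x :=
  fun _ hx ↦ isUnit_of_isTotallyDefinite S.D S.isTotallyDefinite hx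

include hΦ in
/-- **A generator for each forward Hermite form** (density of `Φ(D)`): for every `t` there is a unit `z ∈ O₍ℓ₎` of `D` with
`Φ z ≡ H_t = (1, 0; ℓ^e t, ℓ)` (mod `ℓ^{e+1}`). [cite: VignerasLNM800, Ch. II §2 Thm. 2.3 (3)] -/
theorem exists_hermiteFwd_generator (he : 1 ≤ e) (t : ℕ) :
    ∃ z : S.Dˣ, (z : S.D) ∈ localAt ℓ S.O ∧
      ∀ i j, ‖(Φ z - !![1, 0; (ℓ : ℚ_[ℓ]) ^ e * t, ℓ]) i j‖ ≤ (ℓ : ℝ) ^ (-((e + 1 : ℕ) : ℤ)) := by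
  obtain ⟨b, hb⟩ := AlgHom.exists_norm_sub_le Φ (!![1, 0; (ℓ : ℚ_[ℓ]) ^ e * t, ℓ]) (e + 1)
  obtain ⟨hshape, h00, -⟩ := hermiteFwd_shape he t hb
  have hb0 : b ≠ 0 := fun h ↦ by
    rw [h, map_zero, Matrix.zero_apply, norm_zero] at h00
    exact zero_ne_one h00
  refine ⟨(hdivD _ hb0).unit, ?_, ?_⟩
  · rw [IsUnit.unit_spec, hΦ]; exact hshape
  · rw [IsUnit.unit_spec]; exact hb

/-- For a unit `z ∈ O₍ℓ₎`: `z O₍ℓ₎` has index `ℓ²` iff `‖det Φ z‖ = ℓ⁻¹` (the local norm–index formula of ‹QuaternionSubidealCount›,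
`‖nrd z‖_ℓ = ‖det Φ z‖`). [cite: Voight2021, 16.4.10] -/
theorem relIndex_eq_sq_iff_norm_det {z : S.Dˣ} (hz : (z : S.D) ∈ localAt ℓ S.O) :
    (z • localAt ℓ S.O).toAddSubgroup.relIndex (localAt ℓ S.O).toAddSubgroup = ℓ ^ 2 ↔
      ‖(Φ (z : S.D)).det‖ = (ℓ : ℝ) ^ (-((1 : ℕ) : ℤ)) := by
  rw [← norm_det_algHom_eq hdivD Φ z 1]
  have h := principal_iff (p := ℓ) (isZOrder_g65 S) 1 (z • localAt ℓ S.O)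
  constructor
  · intro hidx
    obtain ⟨z', hz', hv, hzz'⟩ := h.mp ⟨⟨z, hz, rfl⟩, by rw [hidx]⟩
    -- `z O = z' O` with `v(nrd z') = 1`; then `v(nrd z) = 1` too (index is the same)
    exact (isZOrder_g65 S).padicValRat_reducedNorm_of_mem_normLevelUnits ⟨hz, by rw [hidx]⟩
  · intro hv
    have := (h.mpr ⟨z, hz, hv, rfl⟩).2
    rw [this]

include hΦ₁ hΦ in
/-- **Exactly `ℓ` principal right ideals `z O₍ℓ₎` (`z ∈ O₍ℓ₎`) of index `ℓ²` are forward** (`(z O₍ℓ₎) 𝒯₍ℓ₎ ⊄ ℓ O₁,₍ℓ₎`): they are the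
`H_t O₍ℓ₎`, `t < ℓ` — the local count behind «each column of `U_ℓ` sums to `ℓ`». [cite: VignerasLNM800, Ch. II §2 Thm. 2.3 (3)] [cite: BertoliniDarmon2001, §4.1 pp. 142–144] -/
theorem card_forward_localPrincipal (he : 1 ≤ e) :
    Nat.card {N : Submodule ℤ S.D // ((∃ z : S.Dˣ, (z : S.D) ∈ localAt ℓ S.O ∧ N = z • localAt ℓ S.O) ∧
        N.toAddSubgroup.relIndex (localAt ℓ S.O).toAddSubgroup = ℓ ^ 2) ∧
        ¬ N * localAt ℓ (link S.O₁ S.O₂) ≤ ((ℓ : ℕ) : ℤ) • localAt ℓ S.O₁} = ℓ := by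
  classical
  have hO := isZOrder_g65 S
  -- generators `z_t`, `t < ℓ`
  have hgen := fun t : Fin ℓ ↦ exists_hermiteFwd_generator Φ hΦ he (t : ℕ)
  choose z hzO hz using hgen
  have hzshape : ∀ t : Fin ℓ, IsLevelShape e (Φ (z t)) ∧ ‖Φ (z t) 0 0‖ = 1 ∧ ‖(Φ (z t : S.D)).det‖ = (ℓ : ℝ) ^ (-((1 : ℕ) : ℤ)) :=
    fun t ↦ hermiteFwd_shape he (t : ℕ) (hz t)
  -- the family of forward ideals
  let f : Fin ℓ → {N : Submodule ℤ S.D // ((∃ z : S.Dˣ, (z : S.D) ∈ localAt ℓ S.O ∧ N = z • localAt ℓ S.O) ∧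
      N.toAddSubgroup.relIndex (localAt ℓ S.O).toAddSubgroup = ℓ ^ 2) ∧
      ¬ N * localAt ℓ (link S.O₁ S.O₂) ≤ ((ℓ : ℕ) : ℤ) • localAt ℓ S.O₁} := fun t ↦
    ⟨z t • localAt ℓ S.O, ⟨⟨z t, hzO t, rfl⟩, (relIndex_eq_sq_iff_norm_det Φ (hzO t)).mpr (hzshape t).2.2⟩, by
      rw [units_smul_localAt_mul_link_le_iff Φ hΦ₁ hΦ he (hzO t), (hzshape t).2.1]; exact lt_irrefl 1⟩
  have hf : Function.Bijective f := by
    constructor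
    · intro s t hst
      by_contra hne
      have hst' : z s • localAt ℓ S.O = z t • localAt ℓ S.O := congrArg (fun N ↦ (N.1 : Submodule ℤ S.D)) hst
      have hmem := ((hO.mem_stabilizer_localAt_iff (p := ℓ)).mp (units_smul_localAt_eq_iff.mp hst')).1
      rw [hΦ, Units.val_mul, map_mul, algHom_units_inv Φ] at hmem
      exact not_isLevelShape_hermiteFwd_inv_mul he t.isLt s.isLt (fun h ↦ hne (Fin.ext h).symm) (hz t) (hz s) hmem
    · rintro ⟨N, ⟨⟨w, hw, rfl⟩, hidx⟩, hfwd⟩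
      set Z := Φ (w : S.D) with hZ
      have hZshape : IsLevelShape e Z := (hΦ w).mp hw
      have hZ00 : ‖Z 0 0‖ = 1 := by
        rw [units_smul_localAt_mul_link_le_iff Φ hΦ₁ hΦ he hw, not_lt] at hfwd
        exact le_antisymm (hZshape.1 0 0) hfwd
      have hZdet : ‖Z.det‖ = (ℓ : ℝ) ^ (-((1 : ℕ) : ℤ)) := (relIndex_eq_sq_iff_norm_det Φ hw).mp hidx
      -- the residue `t` of `Z₁₀ / (ℓ^e Z₀₀)`
      have hZ00ne : Z 0 0 ≠ 0 := fun h ↦ by rw [h, norm_zero] at hZ00; exact zero_ne_one hZ00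
      have hℓe0 : (ℓ : ℚ_[ℓ]) ^ e ≠ 0 := pow_ne_zero e (by exact_mod_cast hℓ.out.ne_zero)
      set x : ℚ_[ℓ] := Z 1 0 * ((ℓ : ℚ_[ℓ]) ^ e * Z 0 0)⁻¹ with hx
      have hden : ‖(ℓ : ℚ_[ℓ]) ^ e * Z 0 0‖ = (ℓ : ℝ) ^ (-(e : ℤ)) := by rw [norm_mul, norm_ell_pow, hZ00, mul_one]
      have hx1 : ‖x‖ ≤ 1 := by
        rw [hx, norm_mul, norm_inv, hden]
        calc ‖Z 1 0‖ * ((ℓ : ℝ) ^ (-(e : ℤ)))⁻¹ ≤ (ℓ : ℝ) ^ (-(e : ℤ)) * ((ℓ : ℝ) ^ (-(e : ℤ)))⁻¹ := by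
              gcongr; exact hZshape.2
          _ = 1 := mul_inv_cancel₀ (zpow_pos (by exact_mod_cast hℓ.out.pos : (0 : ℝ) < ℓ) _).ne'
      obtain ⟨t, htℓ, ht⟩ := PadicInt.exists_mem_range (⟨x, hx1⟩ : ℤ_[ℓ])
      have hxt : ‖x - (t : ℚ_[ℓ])‖ ≤ (ℓ : ℝ)⁻¹ := by
        rw [IsLocalRing.mem_maximalIdeal, PadicInt.mem_nonunits, PadicInt.norm_def, PadicInt.coe_sub, PadicInt.coe_natCast] at ht
        exact (Padic.norm_lt_one_iff_le_inv _).mp ht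
      have hZt : ‖Z 1 0 - (ℓ : ℚ_[ℓ]) ^ e * t * Z 0 0‖ ≤ (ℓ : ℝ) ^ (-((e + 1 : ℕ) : ℤ)) := by
        have e1 : Z 1 0 - (ℓ : ℚ_[ℓ]) ^ e * t * Z 0 0 = (x - t) * ((ℓ : ℚ_[ℓ]) ^ e * Z 0 0) := by
          rw [hx]; field_simp
        rw [e1, norm_mul, hden, ← ell_mul_zpow_neg_succ e, ← mul_assoc]
        calc ‖x - ↑t‖ * ↑ℓ * (ℓ : ℝ) ^ (-((e + 1 : ℕ) : ℤ)) ≤ (ℓ : ℝ)⁻¹ * ℓ * (ℓ : ℝ) ^ (-((e + 1 : ℕ) : ℤ)) := by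
              gcongr
          _ = (ℓ : ℝ) ^ (-((e + 1 : ℕ) : ℤ)) := by
              rw [inv_mul_cancel₀ (by exact_mod_cast hℓ.out.ne_zero : (ℓ : ℝ) ≠ 0), one_mul]
      -- `z_t⁻¹ w` is a unit of `O₍ℓ₎`
      obtain ⟨hW, hWdet⟩ := isLevelShape_hermiteFwd_inv_mul he t (hz ⟨t, htℓ⟩) hZshape hZ00 hZdet hZt
      have hWinv := isLevelShape_inv_of_norm_det_eq_one hW hWdet
      have hAunit : IsUnit (Φ (z ⟨t, htℓ⟩ : S.D)).det := (Matrix.isUnit_iff_isUnit_det _).mp ((Units.isUnit _).map Φ)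
      refine ⟨⟨t, htℓ⟩, Subtype.ext ?_⟩
      change z ⟨t, htℓ⟩ • localAt ℓ S.O = w • localAt ℓ S.O
      refine (units_smul_localAt_eq_iff.mpr ((hO.mem_stabilizer_localAt_iff (p := ℓ)).mpr ⟨?_, ?_⟩)).symm
      · rw [hΦ, Units.val_mul, map_mul, algHom_units_inv Φ]; exact hW
      · rw [hΦ, _root_.mul_inv_rev, inv_inv, Units.val_mul, map_mul, algHom_units_inv Φ]
        rw [Matrix.mul_inv_rev, Matrix.nonsing_inv_nonsing_inv _ hAunit] at hWinv
        exact hWinv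
  rw [← Nat.card_eq_of_bijective f hf, Nat.card_eq_fintype_card, Fintype.card_fin]

end Local

/-! ### Column sums of `U_ℓ` -/

section Global

variable {Nplus Nminus : ℕ} (S : XiSetup Nplus Nminus)

/-- **Every invertible right ideal has exactly `ℓ` forward invertible sub-ideals of index `ℓ²`** (`ℓ ∣ N⁺`; forward for the chosen
orientation of the setup). [cite: BertoliniDarmon2001, §4.1 pp. 142–144] [cite: WZhang2014, §3.9 p. 214] -/
theorem ncard_forward_subideals_eq {ℓ : ℕ} (hℓ : ℓ.Prime) (hℓN : ℓ ∣ Nplus) (j : ClassSet S.O) :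
    {M : Submodule ℤ S.D | M ≤ j.rep ∧ M.toAddSubgroup.relIndex j.rep.toAddSubgroup = ℓ ^ 2 ∧
        IsForward S.O₁ S.O₂ ℓ M j.rep ∧ M ∈ rightIdeals S.O}.ncard = ℓ := by
  classical
  haveI : Fact ℓ.Prime := ⟨hℓ⟩
  have hdiv : ∀ x : S.D, x ≠ 0 → IsUnit x := fun x hx ↦ isUnit_of_isTotallyDefinite S.D S.isTotallyDefinite hx
  have hO : IsZOrder S.O := isZOrder_g65 S
  have hri : rightIdeals S.O = invertibleRightIdeals S.O :=
    rightIdeals_eq_invertibleRightIdeals_of_isTotallyDefinite S.isTotallyDefinite hO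
  have hI : IsInvertibleRightIdeal S.O j.rep := by
    have hj := j.rep_mem
    rw [hri] at hj
    exact hj
  have hℓm : ¬ ℓ ∣ Nminus := fun h ↦ hℓ.one_lt.ne' (Nat.eq_one_of_dvd_coprimes S.coprime hℓN h)
  have he : 1 ≤ Nplus.factorization ℓ := (hℓ.dvd_iff_one_le_factorization S.nplus_ne_zero).mp hℓN
  obtain ⟨Φ, hΦ₁, hΦ⟩ := exists_orientedLevelModel S hℓm
  obtain ⟨α, -, hα⟩ := hI.exists_localAt_eq_units_smul hdiv hO ℓ
  have hcount := card_subideals_eq_card_localPrincipal_of_iff hdiv hO hI hα 2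
    (P := fun M ↦ IsForward S.O₁ S.O₂ ℓ M j.rep)
    (Q := fun N ↦ ¬ N * localAt ℓ (link S.O₁ S.O₂) ≤ ((ℓ : ℕ) : ℤ) • localAt ℓ S.O₁)
    (fun M _ hMI hidx ↦ isForward_iff_local S hMI hidx hα)
  rw [card_forward_localPrincipal Φ hΦ₁ hΦ he] at hcount
  rw [← Nat.card_coe_set_eq]
  refine Eq.trans (Nat.card_congr ?_) hcount
  exact
    { toFun := fun M ↦ ⟨⟨M.1, by rw [← hri]; exact M.2.2.2.2⟩, ⟨M.2.1, M.2.2.1⟩, M.2.2.2.1⟩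
      invFun := fun M ↦ ⟨M.1.1, M.2.1.1, M.2.1.2, M.2.2, by rw [hri]; exact M.1.2⟩
      left_inv := fun M ↦ rfl
      right_inv := fun M ↦ rfl }

/-- **Column sums of a filtered Brandt matrix**: `Σ_i T_P(n)_{ij} = #{M ⊆ I_j : [I_j : M] = n², P M I_j, M invertible}` (as
‹BrandtColumnSums› `sum_matrix_eq_ncard`, grouping the invertible sub-ideals of `I_j` by class). [cite: VignerasLNM800, Ch. III §5 exercice 5.8 (a)] -/
theorem sum_matrixWith_eq_ncard [Fintype (ClassSet S.O)] (P : Submodule ℤ S.D → Submodule ℤ S.D → Prop) {n : ℕ} (hn : n ≠ 0)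
    (j : ClassSet S.O) :
    ∑ i, matrixWith S.O P n i j =
      ({M : Submodule ℤ S.D | M ≤ j.rep ∧ M.toAddSubgroup.relIndex j.rep.toAddSubgroup = n ^ 2 ∧ P M j.rep ∧
          M ∈ rightIdeals S.O}.ncard : ℤ) := by
  classical
  haveI : IsAddTorsionFree S.D := S.isAddTorsionFree
  have hcl : ∀ I ∈ rightIdeals S.O, ∀ β : S.Dˣ, β • I ∈ rightIdeals S.O := fun _ hI β ↦
    units_smul_mem_rightIdeals_of_isTotallyDefinite S.isTotallyDefinite S.isEichlerOrder.isOrder hI β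
  set U : Set (Submodule ℤ S.D) := {M | M ≤ j.rep ∧ M.toAddSubgroup.relIndex j.rep.toAddSubgroup = n ^ 2 ∧ P M j.rep ∧
    M ∈ rightIdeals S.O} with hU
  set Bk : ClassSet S.O → Set (Submodule ℤ S.D) := fun k ↦ subidealsWith P n k.rep j.rep with hBk
  have hUfin : U.Finite := finite_setOf_subideal j.rep_mem.1.1 hn _
  have hBfin : ∀ k, (Bk k).Finite := fun k ↦ finite_subidealsWith P k j hn
  have hmemU : ∀ L, L ∈ U ↔ ∃ k, L ∈ Bk k := fun L ↦ by
    constructor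
    · rintro ⟨hle, hidx, hP, hmem⟩
      obtain ⟨k, β, hβ⟩ := (mem_rightIdeals_iff_exists_class hcl L).mp hmem
      exact ⟨k, hle, hidx, hP, β, hβ⟩
    · rintro ⟨k, hle, hidx, hP, β, rfl⟩
      exact ⟨hle, hidx, hP, hcl _ k.rep_mem β⟩
  have hS : hUfin.toFinset = Finset.univ.biUnion fun k ↦ (hBfin k).toFinset := by
    ext L
    rw [Set.Finite.mem_toFinset, hmemU, Finset.mem_biUnion]
    simp only [Finset.mem_univ, true_and, Set.Finite.mem_toFinset]
  have hpd : (↑(Finset.univ : Finset (ClassSet S.O)) : Set (ClassSet S.O)).PairwiseDisjoint fun k ↦ (hBfin k).toFinset :=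
    fun k _ k' _ hkk' ↦ Set.Finite.disjoint_toFinset.mpr
      (Set.disjoint_of_subset (subidealsWith_subset P n _ _) (subidealsWith_subset P n _ _) (disjoint_brandtSet_of_ne j n hkk'))
  rw [Set.ncard_eq_toFinset_card U hUfin, hS, Finset.card_biUnion hpd]
  push_cast
  refine Finset.sum_congr rfl fun k _ ↦ ?_
  rw [matrixWith_apply, Set.ncard_eq_toFinset_card _ (hBfin k)]

/-- **The columns of `U_ℓ` sum to `ℓ`** (`ℓ ∣ N⁺` prime): `Σ_i (U_ℓ)_{ij} = ℓ` for the `U`-operator of the chosen orientation of a Brandt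
setup — Bertolini–Darmon's `U_p`-correspondence has degree `p`; W. Zhang 2014 §3.9. [cite: BertoliniDarmon2001, §4.1 pp. 142–144] [cite: WZhang2014, §3.9 p. 214] -/
theorem sum_uMatrix_eq [Fintype (ClassSet S.O)] {ℓ : ℕ} (hℓ : ℓ.Prime) (hℓN : ℓ ∣ Nplus) (j : ClassSet S.O) :
    ∑ i, S.uMatrix ℓ i j = ℓ := by
  rw [S.uMatrix_def, uMatrix_eq_matrixWith, sum_matrixWith_eq_ncard S _ hℓ.ne_zero j]
  have h := ncard_forward_subideals_eq S hℓ hℓN j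
  have hset : {M : Submodule ℤ S.D | M ≤ j.rep ∧ M.toAddSubgroup.relIndex j.rep.toAddSubgroup = ℓ ^ 2 ∧
      IsForward S.O₁ S.O₂ ℓ M j.rep ∧ M ∈ rightIdeals S.O} =
      {M : Submodule ℤ S.D | M ≤ j.rep ∧ M.toAddSubgroup.relIndex j.rep.toAddSubgroup = ℓ ^ 2 ∧
        IsForward S.O₁ S.O₂ ℓ M j.rep ∧ M ∈ rightIdeals S.O} := rfl
  rw [h]

/-- **`U_ℓ` preserves degree zero** (`ℓ ∣ N⁺` prime): `Σ_c v_c = 0 → Σ_c (U_ℓ v)_c = 0` — VERBATIM the hypothesis `hudeg` of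
‹…LeafPartnerOrdersHeckeTwist› `heckeTwist_of_involution`, now a theorem of the tree. [cite: WZhang2014, §3.9 p. 214] -/
theorem sum_uMatrix_mulVec_eq_zero [Fintype (ClassSet S.O)] {ℓ : ℕ} (hℓ : ℓ.Prime) (hℓN : ℓ ∣ Nplus)
    (v : ClassSet S.O → ℤ) (hv : ∑ c, v c = 0) : ∑ c, (S.uMatrix ℓ *ᵥ v) c = 0 := by
  calc ∑ c, (S.uMatrix ℓ *ᵥ v) c = ∑ d, (∑ c, S.uMatrix ℓ c d) * v d := by
        simp only [mulVec, dotProduct, Finset.sum_mul]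
        rw [Finset.sum_comm]
    _ = ∑ d, (ℓ : ℤ) * v d := Finset.sum_congr rfl fun d _ ↦ by rw [sum_uMatrix_eq S hℓ hℓN d]
    _ = 0 := by rw [← Finset.mul_sum, hv, mul_zero]

end Global

end Summit.BirchSwinnertonDyer.BirchSwinnertonDyer.Theorems.LeafPartnerOrders

end
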